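import Mathlib
import Literature.Probability.LatticeModels.IsingConsistency

/-!
# Planted conditioning of a finite-volume Ising measure is an Ising measure (pinning toolkit, IV)

Route `PlantedPinning` of `Ising3DConformalLimit`, support item stmt-CriticalPhenomena-8455
(`PinningEfficiencyLeOne`).  The finite-volume DLR identity behind the planted-pinning
ensemble: for `P ⊆ Λ`, a fixed boundary condition `η₀` and a pattern `τ` on `Λ`, conditioning
`μ^{η₀}_{Λ;β,h}` on the event "the spins on `P` agree with `τ`" gives the Ising measure on
`Λ ∖ P` with boundary condition fixed to `τ` on `P` and to `η₀` off `Λ`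
(Friedli–Velenik 2017, Lemma 6.7, eq. (6.5); Exercise 3.11), stated at the level of Boltzmann
sums against a `0/1` class kernel `K` (`sum_kernel_isingWeight_eq`), together with the
elementary fact that `μ^η_Λ` depends on `η` only off `Λ` (`isingMeasure_fixed_congr_of_eqOn`).
Inputs: `sum_isingWeight_fixed_eq_sum_sum` (`IsingConsistency.lean`) and
`isingExpect_eq_sum_div`.  No definitions.
-/

namespace Summit.CriticalPhenomena.Ising3DConformalLimit.PlantedPinningCeiling

open Finset MeasureTheory Literature.Probability.LatticeModels

variable {V : Type*} (G : SimpleGraph V) [DecidableEq V] [G.LocallyFinite]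

omit [DecidableEq V] [G.LocallyFinite] in
/-- Two boundary conditions that agree off `Λ` glue every pattern on `Λ` to the same
configuration. [folklore] -/
theorem glue_fixed_congr_of_eqOn {Λ : Finset V} {η η' : SpinConfig V}
    (hη : ∀ x ∉ Λ, η x = η' x) (τ : Λ → ℤˣ) :
    glue Λ τ (.fixed η) = glue Λ τ (.fixed η') := by
  funext x
  by_cases hx : x ∈ Λ
  · rw [glue_apply_of_mem _ _ _ hx, glue_apply_of_mem _ _ _ hx]
  · rw [glue_apply_of_notMem _ _ _ hx, glue_apply_of_notMem _ _ _ hx,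
      BoundaryCondition.outside_fixed, BoundaryCondition.outside_fixed, hη x hx]

/-- **`μ^η_{Λ;β,h}` depends on `η` only through `η|_{Λᶜ}`**: boundary conditions agreeing off
`Λ` give the same finite-volume Gibbs measure (Friedli–Velenik 2017, §3.1, `Ω^η_Λ`).
[cite: FriedliVelenik2017, §3.1] -/
theorem isingMeasure_fixed_congr_of_eqOn {Λ : Finset V} {η η' : SpinConfig V}
    (hη : ∀ x ∉ Λ, η x = η' x) (β h : ℝ) :
    isingMeasure G Λ β h (.fixed η) = isingMeasure G Λ β h (.fixed η') := by
  have hglue : (fun τ : Λ → ℤˣ => glue Λ τ (.fixed η)) = fun τ => glue Λ τ (.fixed η') :=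
    funext fun τ => glue_fixed_congr_of_eqOn hη τ
  have href : isingRef Λ (.fixed η) = isingRef Λ (.fixed η') := by
    unfold isingRef
    rw [hglue]
  have hH : isingHamiltonian G Λ h (.fixed η) = isingHamiltonian G Λ h (.fixed η') := by
    funext σ
    simp only [isingHamiltonian, interactionEdges_fixed]
  unfold isingMeasure
  rw [href, hH]

/-- Expectations agree for boundary conditions agreeing off `Λ`. [cite: FriedliVelenik2017, §3.1] -/
theorem isingExpect_fixed_congr_of_eqOn {Λ : Finset V} {η η' : SpinConfig V}
    (hη : ∀ x ∉ Λ, η x = η' x) (β h : ℝ) (f : SpinConfig V → ℝ) :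
    isingExpect G Λ β h (.fixed η) f = isingExpect G Λ β h (.fixed η') f := by
  simp only [isingExpect, isingMeasure_fixed_congr_of_eqOn G hη β h]

/-- **Planted conditioning = Ising measure on the unpinned sites** (finite-volume DLR,
Friedli–Velenik 2017, Lemma 6.7, eq. (6.5)): for `P ⊆ Λ`, a pattern `τ` on `Λ`, a measurable
observable `f`, and a kernel `K` with `K τ σ = 1` if `σ` and `τ` carry the same spins on `P` and
`K τ σ = 0` otherwise,
`∑_σ K(τ,σ) w^{η₀}_Λ(σ) f(σ ∨ η₀) = (∑_σ K(τ,σ) w^{η₀}_Λ(σ)) · ⟨f⟩^{τ ∨ η₀}_{Λ ∖ P;β,h}`.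
[cite: FriedliVelenik2017, Lemma 6.7, eq. (6.5)] -/
theorem sum_kernel_isingWeight_eq {Λ P : Finset V} (hP : P ⊆ Λ) (β h : ℝ) (η₀ : SpinConfig V)
    {K : (Λ → ℤˣ) → (Λ → ℤˣ) → ℝ}
    (hK1 : ∀ a b, (∀ x ∈ P, spinAt x (glue Λ a (.fixed η₀)) = spinAt x (glue Λ b (.fixed η₀))) →
      K a b = 1)
    (hK0 : ∀ a b, ¬ (∀ x ∈ P, spinAt x (glue Λ a (.fixed η₀)) = spinAt x (glue Λ b (.fixed η₀))) →
      K a b = 0)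
    (τ : Λ → ℤˣ) {f : SpinConfig V → ℝ} (hf : Measurable f) :
    ∑ σ : Λ → ℤˣ, K τ σ * isingWeight G Λ β h (.fixed η₀) σ * f (glue Λ σ (.fixed η₀)) =
      (∑ σ : Λ → ℤˣ, K τ σ * isingWeight G Λ β h (.fixed η₀) σ) *
        isingExpect G (Λ \ P) β h (.fixed (glue Λ τ (.fixed η₀))) f := by
  classical
  -- the unpinned volume `Λ' = Λ ∖ P` and the pinned block `Λ ∖ Λ' (= P)`
  set Λ' : Finset V := Λ \ P with hΛ'
  have hsub : Λ' ⊆ Λ := Finset.sdiff_subset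
  have hDP : ∀ {y : V}, y ∈ Λ \ Λ' → y ∈ P := fun {y} hy => by
    by_contra hyP
    exact (Finset.mem_sdiff.1 hy).2 (Finset.mem_sdiff.2 ⟨(Finset.mem_sdiff.1 hy).1, hyP⟩)
  have hPD : ∀ {x : V}, x ∈ P → x ∈ Λ \ Λ' := fun {x} hx =>
    Finset.mem_sdiff.2 ⟨hP hx, fun h' => (Finset.mem_sdiff.1 h').2 hx⟩
  -- the pinned block of `τ` and the resulting boundary condition
  set τ₂s : ↥(Λ \ Λ') → ℤˣ := fun y => τ ⟨y, (Finset.mem_sdiff.1 y.2).1⟩ with hτ₂s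
  set η₂ : (↥(Λ \ Λ') → ℤˣ) → SpinConfig V := fun τ₂ => glue (Λ \ Λ') τ₂ (.fixed η₀) with hη₂
  -- the agreement condition after the two-step decomposition singles out `τ₂ = τ₂s`
  have hcond : ∀ (τ₂ : ↥(Λ \ Λ') → ℤˣ) (τ₁ : Λ' → ℤˣ),
      (∀ x ∈ P, spinAt x (glue Λ τ (.fixed η₀)) = spinAt x (glue Λ' τ₁ (.fixed (η₂ τ₂)))) ↔
        τ₂ = τ₂s := by
    intro τ₂ τ₁
    have hval : ∀ x (hx : x ∈ P),
        spinAt x (glue Λ τ (.fixed η₀)) = ((τ ⟨x, hP hx⟩ : ℤ) : ℝ) ∧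
        spinAt x (glue Λ' τ₁ (.fixed (η₂ τ₂))) = ((τ₂ ⟨x, hPD hx⟩ : ℤ) : ℝ) := fun x hx => by
      have hxΛ' : x ∉ Λ' := fun h' => (Finset.mem_sdiff.1 h').2 hx
      refine ⟨by simp only [spinAt, glue_apply_of_mem _ _ _ (hP hx)], ?_⟩
      simp only [spinAt, glue_apply_of_notMem _ _ _ hxΛ', BoundaryCondition.outside_fixed, hη₂,
        glue_apply_of_mem _ _ _ (hPD hx)]
    constructor
    · intro hagree
      funext y
      have hy : (y : V) ∈ P := hDP y.2
      have := hagree y hy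
      rw [(hval y hy).1, (hval y hy).2] at this
      have hint : (τ ⟨y, hP hy⟩ : ℤ) = (τ₂ ⟨y, hPD hy⟩ : ℤ) := by exact_mod_cast this
      have := Units.ext hint
      simpa [hτ₂s] using this.symm
    · rintro rfl x hx
      rw [(hval x hx).1, (hval x hx).2]
  -- the two-step decomposition applied to `𝟙{agree} · g`
  have hsum : ∀ g : SpinConfig V → ℝ,
      ∑ σ : Λ → ℤˣ, K τ σ * isingWeight G Λ β h (.fixed η₀) σ * g (glue Λ σ (.fixed η₀)) =
        Real.exp (β * (∑ e ∈ edgesTouching G Λ \ edgesTouching G Λ', bondSpin (η₂ τ₂s) e +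
          h * ∑ x ∈ Λ \ Λ', spinAt x (η₂ τ₂s))) *
        ∑ τ₁ : Λ' → ℤˣ, isingWeight G Λ' β h (.fixed (η₂ τ₂s)) τ₁ *
          g (glue Λ' τ₁ (.fixed (η₂ τ₂s))) := by
    intro g
    have key := sum_isingWeight_fixed_eq_sum_sum G hsub η₀ β h
      (fun ξ => (if ∀ x ∈ P, spinAt x (glue Λ τ (.fixed η₀)) = spinAt x ξ then (1:ℝ) else 0) * g ξ)
    have hK : ∀ σ : Λ → ℤˣ, K τ σ =
        if ∀ x ∈ P, spinAt x (glue Λ τ (.fixed η₀)) = spinAt x (glue Λ σ (.fixed η₀))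
        then (1:ℝ) else 0 := fun σ => by
      split_ifs with hc
      · exact hK1 τ σ hc
      · exact hK0 τ σ hc
    calc ∑ σ : Λ → ℤˣ, K τ σ * isingWeight G Λ β h (.fixed η₀) σ * g (glue Λ σ (.fixed η₀))
        = ∑ σ : Λ → ℤˣ, isingWeight G Λ β h (.fixed η₀) σ *
            ((if ∀ x ∈ P, spinAt x (glue Λ τ (.fixed η₀)) = spinAt x (glue Λ σ (.fixed η₀))
              then (1:ℝ) else 0) * g (glue Λ σ (.fixed η₀))) :=
          Finset.sum_congr rfl fun σ _ => by rw [hK σ]; ring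
      _ = _ := key
      _ = _ := by
        rw [Finset.sum_eq_single τ₂s]
        · congr 1
          refine Finset.sum_congr rfl fun τ₁ _ => ?_
          rw [if_pos ((hcond τ₂s τ₁).2 rfl), one_mul]
        · intro τ₂ _ hne
          apply mul_eq_zero_of_right
          exact Finset.sum_eq_zero fun τ₁ _ => by
            rw [if_neg (fun hc => hne ((hcond τ₂ τ₁).1 hc)), zero_mul, mul_zero]
        · intro hτ; exact absurd (Finset.mem_univ _) hτ
  -- evaluate for `g = f` and `g = 1`
  have hf' := hsum f
  have h1 := hsum (fun _ => 1)
  simp only [mul_one] at h1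
  -- the boundary conditions `η₂ τ₂s` and `glue Λ τ η₀` agree off `Λ'`
  have hbc : ∀ y ∉ Λ', η₂ τ₂s y = glue Λ τ (.fixed η₀) y := by
    intro y hy
    by_cases hyD : y ∈ Λ \ Λ'
    · simp only [hη₂, hτ₂s, glue_apply_of_mem _ _ _ hyD,
        glue_apply_of_mem _ _ _ (Finset.mem_sdiff.1 hyD).1]
    · have hyΛ : y ∉ Λ := fun h' => hyD (Finset.mem_sdiff.2 ⟨h', hy⟩)
      simp only [hη₂, glue_apply_of_notMem _ _ _ hyD, glue_apply_of_notMem _ _ _ hyΛ,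
        BoundaryCondition.outside_fixed]
  have hE : isingExpect G Λ' β h (.fixed (glue Λ τ (.fixed η₀))) f =
      (∑ τ₁ : Λ' → ℤˣ, isingWeight G Λ' β h (.fixed (η₂ τ₂s)) τ₁ *
          f (glue Λ' τ₁ (.fixed (η₂ τ₂s)))) /
        isingPartitionFunction G Λ' β h (.fixed (η₂ τ₂s)) := by
    rw [← isingExpect_fixed_congr_of_eqOn G hbc β h f, isingExpect_eq_sum_div G Λ' h _ β hf]
  have h1' : ∑ σ : Λ → ℤˣ, K τ σ * isingWeight G Λ β h (.fixed η₀) σ =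
      Real.exp (β * (∑ e ∈ edgesTouching G Λ \ edgesTouching G Λ', bondSpin (η₂ τ₂s) e +
          h * ∑ x ∈ Λ \ Λ', spinAt x (η₂ τ₂s))) *
        isingPartitionFunction G Λ' β h (.fixed (η₂ τ₂s)) := h1
  have hZpos := isingPartitionFunction_pos G Λ' β h (.fixed (η₂ τ₂s))
  rw [hf', h1', hE]
  field_simp

end Summit.CriticalPhenomena.Ising3DConformalLimit.PlantedPinningCeiling
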